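import Mathlib
import Summits.Ventures.PercRepro2.TB14TrivialCore

/-!
# Row 2′TB, the trivial-core slice (II): the star flip of `o`'s component is an INVOLUTION
(blind cell PercRepro2, mine-c g23, 2026-08-26; `conjectures/MINE-C.md` §32.0 (iii); part I =
`TB14TrivialCore.lean`: `Arm`, `oComp`, `TrivCore`, `admissible_oComp`, `isTgt_starFlip_oComp`)

For a trivial-core source `y` with `Z := oComp y` (the component of `o` in `G[U ∖ {a₂}]`):
* `conn_starFlip_iff`: the red cluster of `a₂` after the flip is `T_r ∖ Z`;
* `conn_blue_starFlip_iff`: the blue cluster after the flip is `T_b ∪ Z`;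
* `trivCore_starFlip`, `arm_starFlip_iff`, `oComp_starFlip`: the core stays `{a₂}`, the arm set
  `U ∖ {a₂}` is unchanged, and so is `Z` — hence (`starFlip_starFlip`) the flip is an involution;
* `card_trivSrc_le_card_trivTgt`: the trivial-core SOURCES inject into the trivial-core TARGETS at
  the all-free profile of every finite multigraph (`trivSrc`, `trivTgt`; the mark `b` is carried
  by `isTgt_starFlip`).  Own work; standard axioms.
-/

namespace Summit.Ventures.PercRepro2

namespace TB14TrivialCoreInv

open CovForm A3InactiveTyped TB14FlipFamily TB14Hall TB14TrivialCore

section Flip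

variable {V : Type} {E : Type} [DecidableEq E] [Fintype V]
variable (ends : E → Sym2 V) (a₁ a₂ b o : V) (F : Finset E)

omit [DecidableEq E] [Fintype V] in
/-- The star flip is an involution. -/
lemma starFlip_starFlip (Z : Finset V) (y : Config E) :
    starFlip ends Z (starFlip ends Z y) = y := by
  funext e
  by_cases h : Touch ends Z e
  · rw [starFlip_of_touch ends h, starFlip_of_touch ends h, Bool.not_not]
  · rw [starFlip_of_not_touch ends h, starFlip_of_not_touch ends h]

/-- **(R)** After the flip the red cluster of `a₂` is `T_r ∖ C_o`. -/
lemma conn_starFlip_iff (hF : ∀ e, e ∈ F) {y : Config E} (hs : IsSrc ends a₁ a₂ b o F y)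
    (ht : TrivCore ends a₂ F y) (v : V) :
    Conn ends (starFlip ends (oComp ends a₂ o F y) y) a₂ v ↔
      Conn ends y a₂ v ∧ v ∉ oComp ends a₂ o F y := by
  set Z := oComp ends a₂ o F y with hZdef
  have ho : Arm ends a₂ F y o := arm_o_of_isSrc ends a₁ a₂ b o F hs
  have hZ : Admissible ends a₁ a₂ o F Z y := admissible_oComp ends a₁ a₂ b o F hF hs ht
  have ha₂ : a₂ ∉ Z := a2_not_mem_oComp ends a₂ o F ho
  constructor
  · intro hv
    have h' := conn_offZ_of_conn_starFlip ends a₁ a₂ o F hF hZ hv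
    exact ⟨conn_mono (offZ_le ends y) h', not_mem_of_conn_offZ ends ha₂ h'⟩
  · rintro ⟨hv, hvZ⟩
    have key : v ∈ {x : V | x ∈ Z ∨ Conn ends (starFlip ends Z y) a₂ x} := by
      refine mem_of_conn_of_closed (ends := ends) (ω := y) ?_ (Or.inr (conn_refl _ _ _)) hv
      intro x hx z hxz
      obtain ⟨_, e, he, hends⟩ := openGraph_adj.1 hxz
      simp only [Set.mem_setOf_eq] at hx ⊢
      by_cases hxZ : x ∈ Z
      · have hxr : Conn ends y a₂ x := (red_of_mem_oComp ends a₁ a₂ b o F hF hs ht hxZ).1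
        have hzr : Conn ends y a₂ z := conn_trans hxr (conn_of_openAdj ⟨e, he, hends⟩)
        by_cases hza : z = a₂
        · exact Or.inr (hza ▸ conn_refl _ _ _)
        · exact Or.inl (mem_oComp_of_adj ends a₂ o F ho hxZ ⟨hza, Or.inl hzr⟩ hends)
      · rcases hx with hx | hx
        · exact absurd hx hxZ
        · by_cases hzZ : z ∈ Z
          · exact Or.inl hzZ
          · have hT : ¬ Touch ends Z e := fun hT =>
              (mem_or_mem_of_touch ends hends hT).elim hxZ hzZ
            have he' : starFlip ends Z y e = true := by
              rw [starFlip_of_not_touch ends hT]; exact he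
            exact Or.inr (conn_trans hx (conn_of_openAdj ⟨e, he', hends⟩))
    simp only [Set.mem_setOf_eq] at key
    exact key.resolve_left hvZ

/-- **(B)** After the flip the blue cluster of `a₂` is `T_b ∪ C_o`. -/
lemma conn_blue_starFlip_iff (hF : ∀ e, e ∈ F) {y : Config E} (hs : IsSrc ends a₁ a₂ b o F y)
    (ht : TrivCore ends a₂ F y) (v : V) :
    Conn ends (flipOn F (starFlip ends (oComp ends a₂ o F y) y)) a₂ v ↔
      Conn ends (flipOn F y) a₂ v ∨ v ∈ oComp ends a₂ o F y := by
  set Z := oComp ends a₂ o F y with hZdef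
  have ho : Arm ends a₂ F y o := arm_o_of_isSrc ends a₁ a₂ b o F hs
  have hZ : Admissible ends a₁ a₂ o F Z y := admissible_oComp ends a₁ a₂ b o F hF hs ht
  constructor
  · intro hv
    have key : v ∈ {x : V | Conn ends (flipOn F y) a₂ x ∨ x ∈ Z} := by
      refine mem_of_conn_of_closed (ends := ends) (ω := flipOn F (starFlip ends Z y)) ?_
        (Or.inl (conn_refl _ _ _)) hv
      intro x hx z hxz
      obtain ⟨_, e, he, hends⟩ := openGraph_adj.1 hxz
      simp only [Set.mem_setOf_eq] at hx ⊢
      by_cases hT : Touch ends Z e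
      · rw [flipOn_starFlip_of_touch ends F hF hT] at he
        by_cases hzZ : z ∈ Z
        · exact Or.inr hzZ
        · have hxZ : x ∈ Z := (mem_or_mem_of_touch ends hends hT).resolve_right hzZ
          have hxr : Conn ends y a₂ x := (red_of_mem_oComp ends a₁ a₂ b o F hF hs ht hxZ).1
          have hzr : Conn ends y a₂ z := conn_trans hxr (conn_of_openAdj ⟨e, he, hends⟩)
          by_cases hza : z = a₂
          · exact Or.inl (hza ▸ conn_refl _ _ _)
          · exact absurd (mem_oComp_of_adj ends a₂ o F ho hxZ ⟨hza, Or.inl hzr⟩ hends) hzZ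
      · rw [flipOn_starFlip_of_not_touch ends F hF hT] at he
        have hxZ : x ∉ Z := fun h => hT (touch_of_ends ends hends h)
        rcases hx with hx | hx
        · exact Or.inl (conn_trans hx (conn_of_openAdj ⟨e, he, hends⟩))
        · exact absurd hx hxZ
    simpa only [Set.mem_setOf_eq] using key
  · rintro (hv | hv)
    · exact conn_blue_starFlip_a2_of_conn ends a₁ a₂ o F hF hZ hv
    · have hroute := route_of_mem_oComp ends a₁ a₂ b o F hF hs ht hv
      exact conn_symm (conn_mono (routeCfg_le_flipOn_starFlip ends F hF Z a₂ y) hroute)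

/-- The flip of a trivial-core source has a trivial core. -/
lemma trivCore_starFlip (hF : ∀ e, e ∈ F) {y : Config E} (hs : IsSrc ends a₁ a₂ b o F y)
    (ht : TrivCore ends a₂ F y) : TrivCore ends a₂ F (starFlip ends (oComp ends a₂ o F y) y) := by
  intro v hr hb
  obtain ⟨hvr, hvZ⟩ := (conn_starFlip_iff ends a₁ a₂ b o F hF hs ht v).1 hr
  rcases (conn_blue_starFlip_iff ends a₁ a₂ b o F hF hs ht v).1 hb with hvb | hvZ'
  · exact ht v hvr hvb
  · exact absurd hvZ' hvZ

/-- The arm set is unchanged by the flip. -/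
lemma arm_starFlip_iff (hF : ∀ e, e ∈ F) {y : Config E} (hs : IsSrc ends a₁ a₂ b o F y)
    (ht : TrivCore ends a₂ F y) (v : V) :
    Arm ends a₂ F (starFlip ends (oComp ends a₂ o F y) y) v ↔ Arm ends a₂ F y v := by
  constructor
  · rintro ⟨hv, h | h⟩
    · exact ⟨hv, Or.inl ((conn_starFlip_iff ends a₁ a₂ b o F hF hs ht v).1 h).1⟩
    · rcases (conn_blue_starFlip_iff ends a₁ a₂ b o F hF hs ht v).1 h with h' | h'
      · exact ⟨hv, Or.inr h'⟩
      · exact ⟨hv, Or.inl (red_of_mem_oComp ends a₁ a₂ b o F hF hs ht h').1⟩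
  · rintro ⟨hv, h | h⟩
    · by_cases hZ : v ∈ oComp ends a₂ o F y
      · exact ⟨hv, Or.inr ((conn_blue_starFlip_iff ends a₁ a₂ b o F hF hs ht v).2 (Or.inr hZ))⟩
      · exact ⟨hv, Or.inl ((conn_starFlip_iff ends a₁ a₂ b o F hF hs ht v).2 ⟨h, hZ⟩)⟩
    · exact ⟨hv, Or.inr ((conn_blue_starFlip_iff ends a₁ a₂ b o F hF hs ht v).2 (Or.inl h))⟩

/-- `armCfg` is unchanged by the flip. -/
lemma armCfg_starFlip (hF : ∀ e, e ∈ F) {y : Config E} (hs : IsSrc ends a₁ a₂ b o F y)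
    (ht : TrivCore ends a₂ F y) :
    armCfg ends a₂ F (starFlip ends (oComp ends a₂ o F y) y) = armCfg ends a₂ F y := by
  classical
  funext e
  unfold armCfg
  rw [decide_eq_decide]
  exact forall_congr' fun x => forall_congr' fun _ => arm_starFlip_iff ends a₁ a₂ b o F hF hs ht x

/-- **`C_o` is unchanged by the flip**: the same component of the same set `U ∖ {a₂}`. -/
lemma oComp_starFlip (hF : ∀ e, e ∈ F) {y : Config E} (hs : IsSrc ends a₁ a₂ b o F y)
    (ht : TrivCore ends a₂ F y) :
    oComp ends a₂ o F (starFlip ends (oComp ends a₂ o F y) y) = oComp ends a₂ o F y := by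
  ext v
  rw [mem_oComp_iff, mem_oComp_iff, armCfg_starFlip ends a₁ a₂ b o F hF hs ht]

end Flip

section Count

variable {V : Type} {E : Type} [Fintype E] [DecidableEq E] [Fintype V]
variable (ends : E → Sym2 V) (a₁ a₂ b o : V)

open Classical in
/-- The trivial-core sources at the all-free profile. -/
noncomputable def trivSrc : Finset (Config E) :=
  (srcSet ends a₁ a₂ b o Finset.univ (fun _ => false)).filter fun y =>
    TrivCore ends a₂ Finset.univ y

open Classical in
/-- The trivial-core targets at the all-free profile. -/
noncomputable def trivTgt : Finset (Config E) :=
  (tgtSet ends a₁ a₂ b o Finset.univ (fun _ => false)).filter fun y =>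
    TrivCore ends a₂ Finset.univ y

/-- **THE TRIVIAL-CORE THEOREM**: the star flip of `o`'s component injects the trivial-core sources
of row 2′TB into its trivial-core targets (all-free profile, every finite multigraph, the mark `b`
carried along) — the slice `K = {a₂}` of the row is an involution. -/
theorem card_trivSrc_le_card_trivTgt :
    (trivSrc ends a₁ a₂ b o).card ≤ (trivTgt ends a₁ a₂ b o).card := by
  classical
  have hF : ∀ e, e ∈ (Finset.univ : Finset E) := fun e => Finset.mem_univ e
  have hsrc : ∀ y ∈ trivSrc ends a₁ a₂ b o,
      IsSrc ends a₁ a₂ b o Finset.univ y ∧ TrivCore ends a₂ Finset.univ y := by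
    intro y hy
    unfold trivSrc at hy
    rw [Finset.mem_filter] at hy
    unfold srcSet at hy
    rw [Finset.mem_filter] at hy
    exact ⟨hy.1.2.2, hy.2⟩
  refine Finset.card_le_card_of_injOn
    (fun y => starFlip ends (oComp ends a₂ o Finset.univ y) y) ?_ ?_
  · intro y hy
    rw [Finset.mem_coe] at hy
    obtain ⟨hs, ht⟩ := hsrc y hy
    rw [Finset.mem_coe]
    show starFlip ends (oComp ends a₂ o Finset.univ y) y ∈ trivTgt ends a₁ a₂ b o
    unfold trivTgt
    rw [Finset.mem_filter]
    refine ⟨?_, trivCore_starFlip ends a₁ a₂ b o Finset.univ hF hs ht⟩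
    unfold tgtSet
    rw [Finset.mem_filter]
    exact ⟨Finset.mem_univ _, fun e he => absurd (hF e) he,
      isTgt_starFlip_oComp ends a₁ a₂ b o Finset.univ hF hs ht⟩
  · intro y₁ hy₁ y₂ hy₂ heq
    rw [Finset.mem_coe] at hy₁ hy₂
    obtain ⟨hs₁, ht₁⟩ := hsrc y₁ hy₁
    obtain ⟨hs₂, ht₂⟩ := hsrc y₂ hy₂
    simp only at heq
    have h₁ := oComp_starFlip ends a₁ a₂ b o Finset.univ hF hs₁ ht₁
    have h₂ := oComp_starFlip ends a₁ a₂ b o Finset.univ hF hs₂ ht₂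
    have hZ : oComp ends a₂ o Finset.univ y₁ = oComp ends a₂ o Finset.univ y₂ := by
      rw [← h₁, ← h₂, heq]
    calc y₁ = starFlip ends (oComp ends a₂ o Finset.univ y₁)
            (starFlip ends (oComp ends a₂ o Finset.univ y₁) y₁) :=
          (starFlip_starFlip ends _ y₁).symm
      _ = starFlip ends (oComp ends a₂ o Finset.univ y₂)
            (starFlip ends (oComp ends a₂ o Finset.univ y₂) y₂) := by rw [heq, hZ]
      _ = y₂ := starFlip_starFlip ends _ y₂

end Count

end TB14TrivialCoreInv

end Summit.Ventures.PercRepro2
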